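import Summits.NavierStokesRegularity.NavierStokesRegularity.Theses.OddMorawetz
import Summits.NavierStokesRegularity.NavierStokesRegularity.Theorems.OddMorawetzOrderThreeIndefiniteFields

/-!
# Route OddMorawetz — `OrderThreeIndefinite` (item stmt-NavierStokesRegularity-1379)

The order-3 run of the odd-Morawetz hunt is NEGATIVE, as the planner expected: the exact Euler derivative
`Q_R = -dR/dt|_{Euler}` of the enstrophy-production functional `R(v) = ∫ ω·(∇v)ω` (Betchov 1956; Lu–Doering 2008),
`Q_R(v) = -∫ (⟪curl b, Dv ω⟫ + ⟪ω, Db ω⟫ + ⟪ω, Dv curl b⟫)` with `b = B(v,v)` the Leray-projected nonlinearity of the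
tree (`Literature.Analysis.FluidPDE.eulerBilinear`, pressure included) and `ω = curl v`, takes BOTH signs on
divergence-free Schwartz fields, so no nonzero multiple of `R` is an order-3 Morawetz functional for 3-D Euler.

Witnesses (exact values, `OddMorawetzOrderThreeIndefiniteFields`): the Gaussian vortex `v₋ = (-x₁, x₀, 0) e^{-|x|²}`
has `Q_R(v₋) = -π√π/320 < 0` (strain production `∫|Sω|²` beats the pressure-Hessian term), and the planar field
`v₊ = (-2x₀x₁, 2x₀² - 1, 0) e^{-|x|²}` has `Q_R(v₊) = +11π√π/1280 > 0` (the nonlocal pressure-Hessian term wins).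
Method: `Q_R(v) = ∫⟪b, G⟫` after three integrations by parts (`G = ∑ⱼ∂ⱼΨⱼ` explicit), `b = -½ P W`, duality for the
Leray projector on the Fourier side, `𝓕` of Hermite–Gaussians, and the Riesz-type integrals
`∫ ξ^{2α} e^{-π²|ξ|²}/|ξ|²` by heat subordination — all exact Gaussian moments (`…Duality`, `…Moments`, `…Value`).

## References
* R. Betchov, *An inequality concerning the production of vorticity in isotropic turbulence*, JFM 1 (1956).
* L. Lu, C. R. Doering, *Limits on enstrophy growth for solutions of the 3D Navier–Stokes equations*, IUMJ 57 (2008).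
* E. M. Stein, *Singular integrals and differentiability properties of functions* (1970), Ch. III §1.3.
-/

noncomputable section

open MeasureTheory SchwartzMap MvPolynomial
open scoped RealInnerProductSpace LineDeriv

-- the problem namespace `Summit.NavierStokesRegularity.NavierStokesRegularity` repeats the summit name by design (D-0017)
set_option linter.dupNamespace false

namespace Summit.NavierStokesRegularity.NavierStokesRegularity.Theorems.OddMorawetz

open Real Literature.Analysis Literature.Analysis.FluidPDE

/-! ### The item -/

section Main
open Real Literature.Analysis Literature.Analysis.FluidPDE

/-- **`OrderThreeIndefinite`**: the order-3 Euler-derivative form `Q_R` takes both signs on divergence-free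
Schwartz fields — `Q_R(v₋) = -π√π/320 < 0` and `Q_R(v₊) = 11π√π/1280 > 0` for the explicit polynomial Gaussians
`v₋ = (-x₁, x₀, 0) e^{-|x|²}`, `v₊ = (-2x₀x₁, 2x₀²-1, 0) e^{-|x|²}`; given `a ≠ 0`, one of them makes `a · Q_R < 0`. -/
theorem _root_.Summit.NavierStokesRegularity.NavierStokesRegularity.Theorems.oddMorawetz_orderThreeIndefinite_proof :
    Summit.NavierStokesRegularity.NavierStokesRegularity.Theses.OddMorawetz.OrderThreeIndefinite := by
  intro a ha
  have hπ : 0 < π * Real.sqrt π := mul_pos pi_pos (Real.sqrt_pos.2 pi_pos)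
  rcases lt_or_gt_of_ne ha with hneg | hpos
  · refine ⟨pgv 1 (![-(2 * X 0 * X 1), 2 * X 0 ^ 2 - 1, 0] : Fin 3 → P3), isSchwartzField_pgv 1 one_pos _, isDivFree_pgv _ PP_div, ?_⟩
    show a * -∫ x, (⟪curl (eulerBilinear (pgv 1 (![-(2 * X 0 * X 1), 2 * X 0 ^ 2 - 1, 0] : Fin 3 → P3)) (pgv 1 (![-(2 * X 0 * X 1), 2 * X 0 ^ 2 - 1, 0] : Fin 3 → P3))) x, fderiv ℝ (pgv 1 (![-(2 * X 0 * X 1), 2 * X 0 ^ 2 - 1, 0] : Fin 3 → P3)) x (curl (pgv 1 (![-(2 * X 0 * X 1), 2 * X 0 ^ 2 - 1, 0] : Fin 3 → P3)) x)⟫ +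
        ⟪curl (pgv 1 (![-(2 * X 0 * X 1), 2 * X 0 ^ 2 - 1, 0] : Fin 3 → P3)) x, fderiv ℝ (eulerBilinear (pgv 1 (![-(2 * X 0 * X 1), 2 * X 0 ^ 2 - 1, 0] : Fin 3 → P3)) (pgv 1 (![-(2 * X 0 * X 1), 2 * X 0 ^ 2 - 1, 0] : Fin 3 → P3))) x (curl (pgv 1 (![-(2 * X 0 * X 1), 2 * X 0 ^ 2 - 1, 0] : Fin 3 → P3)) x)⟫ +
          ⟪curl (pgv 1 (![-(2 * X 0 * X 1), 2 * X 0 ^ 2 - 1, 0] : Fin 3 → P3)) x, fderiv ℝ (pgv 1 (![-(2 * X 0 * X 1), 2 * X 0 ^ 2 - 1, 0] : Fin 3 → P3)) x (curl (eulerBilinear (pgv 1 (![-(2 * X 0 * X 1), 2 * X 0 ^ 2 - 1, 0] : Fin 3 → P3)) (pgv 1 (![-(2 * X 0 * X 1), 2 * X 0 ^ 2 - 1, 0] : Fin 3 → P3))) x)⟫) < 0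
    rw [PP_value]
    nlinarith
  · refine ⟨pgv 1 (![-X 1, X 0, 0] : Fin 3 → P3), isSchwartzField_pgv 1 one_pos _, isDivFree_pgv _ PM_div, ?_⟩
    show a * -∫ x, (⟪curl (eulerBilinear (pgv 1 (![-X 1, X 0, 0] : Fin 3 → P3)) (pgv 1 (![-X 1, X 0, 0] : Fin 3 → P3))) x, fderiv ℝ (pgv 1 (![-X 1, X 0, 0] : Fin 3 → P3)) x (curl (pgv 1 (![-X 1, X 0, 0] : Fin 3 → P3)) x)⟫ +
        ⟪curl (pgv 1 (![-X 1, X 0, 0] : Fin 3 → P3)) x, fderiv ℝ (eulerBilinear (pgv 1 (![-X 1, X 0, 0] : Fin 3 → P3)) (pgv 1 (![-X 1, X 0, 0] : Fin 3 → P3))) x (curl (pgv 1 (![-X 1, X 0, 0] : Fin 3 → P3)) x)⟫ +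
          ⟪curl (pgv 1 (![-X 1, X 0, 0] : Fin 3 → P3)) x, fderiv ℝ (pgv 1 (![-X 1, X 0, 0] : Fin 3 → P3)) x (curl (eulerBilinear (pgv 1 (![-X 1, X 0, 0] : Fin 3 → P3)) (pgv 1 (![-X 1, X 0, 0] : Fin 3 → P3))) x)⟫) < 0
    rw [PM_value]
    nlinarith

end Main
end Summit.NavierStokesRegularity.NavierStokesRegularity.Theorems.OddMorawetz
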